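import Mathlib
import Summits.Ventures.FusionMHD.Models.FluxSurfacePolarRayLevelVolume
import Summits.Ventures.FusionMHD.Models.FluxSurfacePolarRayLevelCurrent
import HarnessLib

/-!
# Polar-ray chart: AMPÈRE'S LAW ON AN IMPLICIT FLUX SURFACE — `μ₀ I(u) = ∮ B_p dℓ = ∫∫ Δ*ψ/R dA`, hence for a Solov'ev-class source
# `Δ*ψ = C·R²` the toroidal current within the surface is `C/(2π)` times the VOLUME within it (Green's theorem for the star-shaped
# region, done by hand in the polar chart: a Leibniz rule with a moving upper limit and one exact `θ`-derivative)

LADDER-GRIDFUSION (F2 item R2 / F1 on the Cerfon–Freidberg rung), cell `gridfusion`, seat `gridfusion-model-7` (g6), 2026-08-27.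
Companion of `Models/FluxSurfacePolarRayLevel{Volume,Current,GGJ}.lean`.  WHY: Jardin's (8.134) record of an implicit surface
(`PolarRay.ggjData`) is label-covariant — and its Glasser–Greene–Johnson / resistive-interchange indices are the printed ones — exactly
when the data satisfy the SURFACE-AVERAGED FORCE BALANCE `p′V′ + I′Ψ′ − K′Φ′ = 0` (`MercierFluxForm.lean` §3); with `p′ = −C`,
`Ψ′ = 2π`, `K′ = 0` this is `I′(u) = C·V′(u)/2π`, i.e. the `u`-derivative of AMPÈRE'S LAW `μ₀I(u) = ∫∫_{ψ<u} μ₀J_φ dA = C·V(u)/2π`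
(`μ₀RJ_φ = Δ*ψ = C R²`, `dV = 2πR dA`).  The tree has `V(u) = torVolume` and `dV/du = volumeDerivE` (Volume file); this file proves
the law itself on the glued polar loop, with NO appeal to a general Green theorem (not in Mathlib for such regions).

THE ARGUMENT ([folklore] calculus).  Polar chart `(θ, s) ↦ (R_c + s cos θ, Z_c + s sin θ)`; `D = ∂_sψ(ray)` (radial derivative),
`D_t` the tangential derivative (`∂_θψ(ray) = s·D_t`), `R = R_c + s cos θ`.  The divergence of `∇ψ/R` in the chart reads
`s·Δ*ψ/R = ∂_s(s·D/R) + ∂_θ(D_t/R)` — supplied here as the HYPOTHESIS `hm` on the `s`-primitive (for a `C²` flux it is the chain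
rule + `Δ*ψ = ψ_RR − ψ_R/R + ψ_ZZ`; instances discharge it from closed forms or from `ContDiff`).  With `k = D_t/R` and
`P(θ) = ∫₀^{ρ(θ)} k(θ, σ) dσ`:  `P′ = ∫₀^ρ ∂_θk + k(θ, ρ)·ρ′` (Leibniz with a moving limit, §1), `∫₀^ρ ∂_θk = C·volPrimKernel − ρD/R`
(the hypothesis integrated in `s`), `ρ′ = −ρD_t/D` (implicit differentiation on the level set, Deriv file) ⇒
`P′(θ) = C·volPrimKernel(θ, ρθ) − ρ(D² + D_t²)/(R·D) = C·volPrimKernel − |∇ψ|²ρ/(R·D)`; integrating over a period (`P(2π) = P(0)`)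
gives `∫₀^{2π} |∇ψ|²ρ/(R D) dθ = C∫₀^{2π} volPrimKernel(θ, ρθ) dθ`, i.e. `μ₀·toroidalCurrentE = C·torVolume/2π`.

WHAT IS PROVED:
* §1 `hasDerivAt_integral_movingLimit` — `d/dθ ∫₀^{ρ(θ)} k(θ, σ) dσ = ∫₀^{ρ(θ)} ∂_θk + k(θ, ρθ)·ρ′(θ)` for `k`, `∂_θk` jointly continuous
  on `ℝ × [0, s_max]` and `ρ` differentiable with values in `(0, s_max)` (dominated differentiation + FTC + a uniform-continuity
  little-o estimate for the cross term).
* §2 `hasDerivAt_rayRadius_of_level` — `ρ′ = −ρ·D_t/D_r` for the glued radius of a level traced once (the Loop file's argument, exported).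
* §3 **`ampere_polar`** — the identity above for ONE level under field hypotheses (`D`, `k`, `∂_θk` and the divergence primitive `hm`);
  **`toroidalCurrentE_eq_torVolume`** — `toroidalCurrentE μ₀ ψ (loop R_c Z_c ρ_u) (2π) = C·torVolume ψ R_c Z_c u/(2πμ₀)`
  (Freidberg (6.27) `μ₀I = ∮B_p dℓ`; Jardin (5.34)).
MODELLED: nothing beyond «`ψ` solves `Δ*ψ = C·R²` on the region swept by the rays» (Solov'ev-class: LC/PCF `C = C_s`, CF `α = 0`
`C = 1`).  NOT CLAIMED here: the derivation of the field hypotheses from `C²` regularity (separate lemma/instances); any value.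
-/

noncomputable section

open Real Set Filter Topology MeasureTheory intervalIntegral Asymptotics Metric
open scoped Interval
open Literature.MathematicalPhysics.MHD.GradShafranov

namespace Summit.Ventures.FusionMHD.Models

namespace PolarRay

/-! ## §1 Leibniz rule with a moving upper limit -/

/-- Uniform bound and uniform continuity in the parameter for a kernel jointly continuous on `ℝ × [0, s_max]`, near `θ₀`:
for every `ε > 0` there is `δ > 0` with `|k θ σ − k θ₀ σ| < ε` for `|θ − θ₀| < δ`, `σ ∈ [0, s_max]`. [folklore] -/
theorem kernel_uniform_near {k : ℝ → ℝ → ℝ} {smax θ₀ : ℝ}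
    (hkc : ContinuousOn (fun p : ℝ × ℝ => k p.1 p.2) (univ ×ˢ Icc 0 smax)) {ε : ℝ} (hε : 0 < ε) :
    ∃ δ > 0, ∀ θ σ : ℝ, |θ - θ₀| < δ → σ ∈ Icc 0 smax → |k θ σ - k θ₀ σ| < ε := by
  have hK : IsCompact (Icc (θ₀ - 1) (θ₀ + 1) ×ˢ Icc 0 smax) := isCompact_Icc.prod isCompact_Icc
  have hc : ContinuousOn (fun p : ℝ × ℝ => k p.1 p.2) (Icc (θ₀ - 1) (θ₀ + 1) ×ˢ Icc 0 smax) :=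
    hkc.mono (prod_mono (subset_univ _) le_rfl)
  have hu := hK.uniformContinuousOn_of_continuous hc
  rw [Metric.uniformContinuousOn_iff] at hu
  obtain ⟨δ, hδ, h⟩ := hu ε hε
  refine ⟨min δ 1, lt_min hδ one_pos, fun θ σ hθ hσ => ?_⟩
  have hθ1 : |θ - θ₀| < 1 := hθ.trans_le (min_le_right _ _)
  have hθδ : |θ - θ₀| < δ := hθ.trans_le (min_le_left _ _)
  have hθI : θ ∈ Icc (θ₀ - 1) (θ₀ + 1) := by constructor <;> linarith [(abs_lt.1 hθ1).1, (abs_lt.1 hθ1).2]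
  have hθ₀I : θ₀ ∈ Icc (θ₀ - 1) (θ₀ + 1) := by constructor <;> linarith
  have hd := h (θ, σ) ⟨hθI, hσ⟩ (θ₀, σ) ⟨hθ₀I, hσ⟩ (by
    rw [Prod.dist_eq, Real.dist_eq, Real.dist_eq, sub_self, abs_zero, max_eq_left (abs_nonneg _)]
    exact hθδ)
  rwa [Real.dist_eq] at hd

/-- **LEIBNIZ RULE WITH A MOVING UPPER LIMIT.**  For `k`, `∂_θk = kθ` jointly continuous on `ℝ × [0, s_max]` with
`HasDerivAt (θ ↦ k θ σ) (kθ θ σ) θ` there, and `ρ` differentiable at `θ₀` with `ρ(θ) ∈ (0, s_max)` near `θ₀`: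
`HasDerivAt (θ ↦ ∫₀^{ρ θ} k θ σ dσ) (∫₀^{ρ θ₀} kθ θ₀ σ dσ + k θ₀ (ρ θ₀)·ρ′) θ₀`. [folklore] -/
theorem hasDerivAt_integral_movingLimit {k kθ : ℝ → ℝ → ℝ} {ρ : ℝ → ℝ} {ρ' smax θ₀ : ℝ}
    (hkc : ContinuousOn (fun p : ℝ × ℝ => k p.1 p.2) (univ ×ˢ Icc 0 smax))
    (hkθc : ContinuousOn (fun p : ℝ × ℝ => kθ p.1 p.2) (univ ×ˢ Icc 0 smax))
    (hkθ : ∀ θ : ℝ, ∀ σ ∈ Icc 0 smax, HasDerivAt (fun θ' => k θ' σ) (kθ θ σ) θ)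
    (hρ : HasDerivAt ρ ρ' θ₀) (hρI : ∀ᶠ θ in 𝓝 θ₀, ρ θ ∈ Ioo 0 smax) :
    HasDerivAt (fun θ => ∫ σ in (0 : ℝ)..ρ θ, k θ σ)
      ((∫ σ in (0 : ℝ)..ρ θ₀, kθ θ₀ σ) + k θ₀ (ρ θ₀) * ρ') θ₀ := by
  set r₀ := ρ θ₀ with hr₀
  have hr₀I : r₀ ∈ Ioo 0 smax := hρI.self_of_nhds
  -- slices are continuous on [0, smax]
  have hslice : ∀ θ : ℝ, ContinuousOn (fun σ => k θ σ) (Icc 0 smax) := fun θ =>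
    hkc.comp (continuousOn_const.prodMk continuousOn_id) fun σ hσ => ⟨mem_univ _, hσ⟩
  have hsliceθ : ∀ θ : ℝ, ContinuousOn (fun σ => kθ θ σ) (Icc 0 smax) := fun θ =>
    hkθc.comp (continuousOn_const.prodMk continuousOn_id) fun σ hσ => ⟨mem_univ _, hσ⟩
  have hint : ∀ θ : ℝ, ∀ a b : ℝ, a ∈ Icc 0 smax → b ∈ Icc 0 smax → IntervalIntegrable (fun σ => k θ σ) volume a b :=
    fun θ a b ha hb => ((hslice θ).mono (uIcc_subset_Icc ha hb)).intervalIntegrable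
  have h0I : (0 : ℝ) ∈ Icc 0 smax := ⟨le_rfl, hr₀I.1.le.trans hr₀I.2.le⟩
  have hr₀I' : r₀ ∈ Icc 0 smax := Ioo_subset_Icc_self hr₀I
  -- (A) fixed limits: dominated differentiation
  have hA : HasDerivAt (fun θ => ∫ σ in (0 : ℝ)..r₀, k θ σ) (∫ σ in (0 : ℝ)..r₀, kθ θ₀ σ) θ₀ := by
    have hK : IsCompact (Icc (θ₀ - 1) (θ₀ + 1) ×ˢ Icc 0 smax) := isCompact_Icc.prod isCompact_Icc
    obtain ⟨B, hB⟩ := hK.exists_bound_of_continuousOn (hkθc.mono (prod_mono (subset_univ _) le_rfl))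
    have hs : Ioo (θ₀ - 1) (θ₀ + 1) ∈ 𝓝 θ₀ := Ioo_mem_nhds (by linarith) (by linarith)
    have hIoc : ∀ σ ∈ Ι (0 : ℝ) r₀, σ ∈ Icc 0 smax := fun σ hσ => by
      rw [uIoc_of_le hr₀I.1.le] at hσ; exact ⟨hσ.1.le, hσ.2.trans hr₀I.2.le⟩
    have key := intervalIntegral.hasDerivAt_integral_of_dominated_loc_of_deriv_le (μ := volume) (a := 0) (b := r₀)
      (F := fun θ σ => k θ σ) (F' := fun θ σ => kθ θ σ) (x₀ := θ₀) (bound := fun _ => B) hs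
      (Eventually.of_forall fun θ => by
        rw [uIoc_of_le hr₀I.1.le]
        exact ((hslice θ).mono fun σ hσ => ⟨hσ.1.le, hσ.2.trans hr₀I.2.le⟩).aestronglyMeasurable measurableSet_Ioc)
      (hint θ₀ 0 r₀ h0I hr₀I')
      (by
        rw [uIoc_of_le hr₀I.1.le]
        exact ((hsliceθ θ₀).mono fun σ hσ => ⟨hσ.1.le, hσ.2.trans hr₀I.2.le⟩).aestronglyMeasurable measurableSet_Ioc)
      (Eventually.of_forall fun σ hσ θ hθ => by
        have hθI : θ ∈ Icc (θ₀ - 1) (θ₀ + 1) := Ioo_subset_Icc_self hθ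
        simpa using hB (θ, σ) ⟨hθI, hIoc σ hσ⟩)
      intervalIntegrable_const
      (Eventually.of_forall fun σ hσ θ _ => hkθ θ σ (hIoc σ hσ))
    exact key.2
  -- (B₁) moving limit with the frozen kernel: FTC + chain rule
  have hB₁ : HasDerivAt (fun θ => ∫ σ in r₀..ρ θ, k θ₀ σ) (k θ₀ r₀ * ρ') θ₀ := by
    have hF : HasDerivAt (fun x => ∫ σ in r₀..x, k θ₀ σ) (k θ₀ r₀) r₀ := by
      refine intervalIntegral.integral_hasDerivAt_right (hint θ₀ r₀ r₀ hr₀I' hr₀I') ?_ ?_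
      · exact ((hslice θ₀).mono Ioo_subset_Icc_self).stronglyMeasurableAtFilter isOpen_Ioo _ hr₀I
      · exact (hslice θ₀).continuousAt (Icc_mem_nhds hr₀I.1 hr₀I.2)
    have h := hF.comp θ₀ hρ
    exact h
  -- (B₂) the cross term is little-o
  have hB₂ : HasDerivAt (fun θ => ∫ σ in r₀..ρ θ, (k θ σ - k θ₀ σ)) 0 θ₀ := by
    rw [hasDerivAt_iff_isLittleO]
    simp only [smul_zero, sub_zero, hr₀, integral_same, sub_self]
    rw [Asymptotics.isLittleO_iff]
    intro ε hε
    obtain ⟨Cρ, hCρ, hbig⟩ := (hρ.isBigO_sub).exists_pos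
    rw [Asymptotics.IsBigOWith] at hbig
    obtain ⟨δ, hδ, hunif⟩ := kernel_uniform_near (θ₀ := θ₀) hkc (div_pos hε hCρ)
    filter_upwards [hbig, hρI, Metric.ball_mem_nhds θ₀ hδ] with θ hθbig hθI hθδ
    rw [Metric.mem_ball, Real.dist_eq] at hθδ
    have hsub : ∀ σ ∈ Ι r₀ (ρ θ), σ ∈ Icc 0 smax := fun σ hσ => by
      rcases le_total r₀ (ρ θ) with h | h
      · rw [uIoc_of_le h] at hσ; exact ⟨hr₀I.1.le.trans hσ.1.le, hσ.2.trans hθI.2.le⟩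
      · rw [uIoc_of_ge h] at hσ; exact ⟨hθI.1.le.trans hσ.1.le, hσ.2.trans hr₀I.2.le⟩
    have hbound : ∀ σ ∈ Ι r₀ (ρ θ), ‖k θ σ - k θ₀ σ‖ ≤ ε / Cρ := fun σ hσ => by
      rw [Real.norm_eq_abs]; exact (hunif θ σ hθδ (hsub σ hσ)).le
    have h1 := intervalIntegral.norm_integral_le_of_norm_le_const hbound
    have h2 : |ρ θ - r₀| ≤ Cρ * ‖θ - θ₀‖ := by
      have := hθbig; rw [Real.norm_eq_abs] at this; rw [hr₀]; exact this
    calc ‖∫ σ in r₀..ρ θ, (k θ σ - k θ₀ σ)‖ ≤ ε / Cρ * |ρ θ - r₀| := h1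
      _ ≤ ε / Cρ * (Cρ * ‖θ - θ₀‖) := by gcongr
      _ = ε * ‖θ - θ₀‖ := by field_simp
  -- assemble: near θ₀ the integral splits as A + B₁ + B₂
  have hev : (fun θ => ∫ σ in (0 : ℝ)..ρ θ, k θ σ)
      =ᶠ[𝓝 θ₀] fun θ => (∫ σ in (0 : ℝ)..r₀, k θ σ) + ((∫ σ in r₀..ρ θ, k θ₀ σ) + ∫ σ in r₀..ρ θ, (k θ σ - k θ₀ σ)) := by
    filter_upwards [hρI] with θ hθI
    have hθI' : ρ θ ∈ Icc 0 smax := Ioo_subset_Icc_self hθI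
    rw [← intervalIntegral.integral_add (hint θ₀ r₀ (ρ θ) hr₀I' hθI') ((hint θ r₀ (ρ θ) hr₀I' hθI').sub
      (hint θ₀ r₀ (ρ θ) hr₀I' hθI'))]
    simp only [add_sub_cancel]
    rw [intervalIntegral.integral_add_adjacent_intervals (hint θ 0 r₀ h0I hr₀I') (hint θ r₀ (ρ θ) hr₀I' hθI')]
  have hsum := hA.add (hB₁.add hB₂)
  simp only [add_zero] at hsum
  exact hsum.congr_of_eventuallyEq hev

/-! ## §2 The glued radius of a level traced once is differentiable: `ρ′ = −ρ·D_t/D_r` -/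

/-- **`ρ′ = −ρ·D_t/D_r`** for the glued radius `ρ = rayRadius ψ R_c Z_c u` of a level traced once (level identity on a period,
continuity on a period, `ψ` Fréchet-differentiable at the surface point with `D_r ≠ 0`) — the Loop file's implicit differentiation,
exported. [folklore] -/
theorem hasDerivAt_rayRadius_of_level {ψ : ℝ → ℝ → ℝ} {Rc Zc u θ : ℝ} {Lθ : ℝ × ℝ →L[ℝ] ℝ}
    (hlev : ∀ θ ∈ Icc 0 (2 * π), rayProfile ψ Rc Zc θ (rayRadius ψ Rc Zc u θ) = u)
    (hcont : ContinuousOn (rayRadius ψ Rc Zc u) (Icc 0 (2 * π)))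
    (hψ : HasFDerivAt (fun p : ℝ × ℝ => ψ p.1 p.2) Lθ (loop Rc Zc (rayRadius ψ Rc Zc u) θ))
    (hDr : radialDeriv (Lθ (1, 0)) (Lθ (0, 1)) θ ≠ 0) :
    HasDerivAt (rayRadius ψ Rc Zc u)
      (-(rayRadius ψ Rc Zc u θ * tangentialDeriv (Lθ (1, 0)) (Lθ (0, 1)) θ) / radialDeriv (Lθ (1, 0)) (Lθ (0, 1)) θ) θ := by
  set ρ := rayRadius ψ Rc Zc u with hρdef
  have hper : Function.Periodic ρ (2 * π) := periodic_rayRadius ψ Rc Zc u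
  have hG : Function.Periodic (fun θ => rayProfile ψ Rc Zc θ (ρ θ)) (2 * π) := by
    intro θ; simp only [hper θ, periodic_rayProfile ψ Rc Zc _ θ]
  have hlev' : ∀ θ, rayProfile ψ Rc Zc θ (ρ θ) = u := eq_of_periodic_of_eqOn_Icc hG two_pi_pos hlev
  have hρc : Continuous ρ := continuous_of_periodic_of_continuousOn_Icc hper two_pi_pos hcont
  have hψ' : HasFDerivAt (fun p : ℝ × ℝ => ψ p.1 p.2) Lθ (rayPoint Rc Zc θ (ρ θ)) := by
    rw [← loop_eq_rayPoint]; exact hψ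
  have hL := hasFDerivAt_rayProfile hψ'
  have hlevel_ev : ∀ᶠ t in 𝓝 θ, (fun p : ℝ × ℝ => rayProfile ψ Rc Zc p.1 p.2) (t, ρ t)
      = (fun p : ℝ × ℝ => rayProfile ψ Rc Zc p.1 p.2) (θ, ρ θ) :=
    Eventually.of_forall fun t => by simp only [hlev']
  have h := hasDerivAt_of_implicit (F := fun p : ℝ × ℝ => rayProfile ψ Rc Zc p.1 p.2) (g := ρ) (x₀ := θ)
    hρc.continuousAt hlevel_ev hL (by rw [rayProfile_partial_s]; exact hDr)
  rw [rayProfile_partial_theta, rayProfile_partial_s] at h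
  exact h

/-! ## §3 Ampère's law on the glued loop -/

section ampere

variable {ψ : ℝ → ℝ → ℝ} {Rc Zc u smax C : ℝ} {D k kθ : ℝ → ℝ → ℝ} {L : ℝ → (ℝ × ℝ →L[ℝ] ℝ)}

/-- **AMPÈRE'S LAW IN THE POLAR CHART** (`∮ B_p dℓ = ∫∫ Δ*ψ/R dA` for the star-shaped region inside the level `ψ = u`, with
`Δ*ψ = C·R²`): `∫₀^{2π} |∇ψ|²(γθ)·ρ/(R·|D_r|) dθ = C·∫₀^{2π} volPrimKernel R_c θ (ρ θ) dθ`.  Hypotheses: the surface data of the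
Loop file's §1 (`hlev`, `hcont`, `hψ`, `R > 0`), `ρ ∈ (0, s_max)` on the period; a radial-derivative field `D` and a field `k`
(`= D_t/R`) identified at the surface with `radialDeriv`/`tangentialDeriv` of `L θ`, `D > 0` there; `k`, `∂_θk` jointly continuous on
`ℝ × [0, s_max]`, `k(2π, ·) = k(0, ·)`; and the DIVERGENCE PRIMITIVE `hm`: `HasDerivAt (s ↦ s·D/R) (C·s·R − ∂_θk) s` on
`ℝ × [0, s_max]` (the polar form of `Δ*ψ = C·R²`); plus integrability of the current integrand on the period.
[cite: Freidberg2014, §6.3.3 eq. (6.27)] -/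
theorem ampere_polar
    (hlev : ∀ θ ∈ Icc 0 (2 * π), rayProfile ψ Rc Zc θ (rayRadius ψ Rc Zc u θ) = u)
    (hcont : ContinuousOn (rayRadius ψ Rc Zc u) (Icc 0 (2 * π)))
    (hρI : ∀ θ ∈ Icc 0 (2 * π), rayRadius ψ Rc Zc u θ ∈ Ioo 0 smax)
    (hψ : ∀ θ ∈ uIcc 0 (2 * π), HasFDerivAt (fun p : ℝ × ℝ => ψ p.1 p.2) (L θ) (loop Rc Zc (rayRadius ψ Rc Zc u) θ))
    (hD : ∀ θ ∈ uIcc 0 (2 * π), D θ (rayRadius ψ Rc Zc u θ) = radialDeriv (L θ (1, 0)) (L θ (0, 1)) θ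
      ∧ 0 < D θ (rayRadius ψ Rc Zc u θ))
    (hk : ∀ θ ∈ uIcc 0 (2 * π), k θ (rayRadius ψ Rc Zc u θ) * (Rc + rayRadius ψ Rc Zc u θ * cos θ)
      = tangentialDeriv (L θ (1, 0)) (L θ (0, 1)) θ)
    (hR : ∀ θ ∈ uIcc 0 (2 * π), 0 < Rc + rayRadius ψ Rc Zc u θ * cos θ)
    (hkc : ContinuousOn (fun p : ℝ × ℝ => k p.1 p.2) (univ ×ˢ Icc 0 smax))
    (hkθc : ContinuousOn (fun p : ℝ × ℝ => kθ p.1 p.2) (univ ×ˢ Icc 0 smax))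
    (hkθ : ∀ θ : ℝ, ∀ σ ∈ Icc 0 smax, HasDerivAt (fun θ' => k θ' σ) (kθ θ σ) θ)
    (hkper : ∀ σ : ℝ, k (2 * π) σ = k 0 σ)
    (hm : ∀ θ : ℝ, ∀ σ ∈ Icc 0 smax,
      HasDerivAt (fun s => s * D θ s / (Rc + s * cos θ)) (C * σ * (Rc + σ * cos θ) - kθ θ σ) σ)
    (hIint : IntervalIntegrable (fun θ => ((L θ (1, 0)) ^ 2 + (L θ (0, 1)) ^ 2)
      * (rayRadius ψ Rc Zc u θ / ((loop Rc Zc (rayRadius ψ Rc Zc u) θ).1 * |radialDeriv (L θ (1, 0)) (L θ (0, 1)) θ|)))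
      volume 0 (2 * π)) :
    ∫ θ in (0 : ℝ)..(2 * π), ((L θ (1, 0)) ^ 2 + (L θ (0, 1)) ^ 2)
        * (rayRadius ψ Rc Zc u θ / ((loop Rc Zc (rayRadius ψ Rc Zc u) θ).1 * |radialDeriv (L θ (1, 0)) (L θ (0, 1)) θ|))
      = C * ∫ θ in (0 : ℝ)..(2 * π), volPrimKernel Rc θ (rayRadius ψ Rc Zc u θ) := by
  set ρ := rayRadius ψ Rc Zc u with hρdef
  have hI : uIcc 0 (2 * π) = Icc 0 (2 * π) := uIcc_of_le two_pi_pos.le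
  have hper : Function.Periodic ρ (2 * π) := periodic_rayRadius ψ Rc Zc u
  have hρc : Continuous ρ := continuous_of_periodic_of_continuousOn_Icc hper two_pi_pos hcont
  -- ρ ∈ (0, smax) everywhere (periodic extension)
  have hρI' : ∀ θ : ℝ, ρ θ ∈ Ioo 0 smax := fun θ => by
    obtain ⟨y, hy, hθy⟩ := hper.exists_mem_Ico₀ two_pi_pos θ
    rw [hθy]; exact hρI y (Ico_subset_Icc_self hy)
  -- the primitive P(θ) = ∫₀^{ρ θ} k θ σ dσ and its derivative on the period
  set P : ℝ → ℝ := fun θ => ∫ σ in (0 : ℝ)..ρ θ, k θ σ with hPdef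
  -- slices
  have hsliceθ : ∀ θ : ℝ, ContinuousOn (fun σ => kθ θ σ) (Icc 0 smax) := fun θ =>
    hkθc.comp (continuousOn_const.prodMk continuousOn_id) fun σ hσ => ⟨mem_univ _, hσ⟩
  -- ∫₀^ρ ∂_θk = C volPrimKernel − ρ D/R  (the divergence primitive integrated in s)
  have hdiv : ∀ θ : ℝ, ∫ σ in (0 : ℝ)..ρ θ, kθ θ σ
      = C * volPrimKernel Rc θ (ρ θ) - ρ θ * D θ (ρ θ) / (Rc + ρ θ * cos θ) := by
    intro θ
    have hρ0 := (hρI' θ).1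
    have hsub : ∀ σ ∈ uIcc (0 : ℝ) (ρ θ), σ ∈ Icc 0 smax := fun σ hσ => by
      rw [uIcc_of_le hρ0.le] at hσ; exact ⟨hσ.1, hσ.2.trans (hρI' θ).2.le⟩
    have hcint : IntervalIntegrable (fun σ => C * σ * (Rc + σ * cos θ) - kθ θ σ) volume 0 (ρ θ) := by
      refine (ContinuousOn.intervalIntegrable ?_)
      exact (by fun_prop : ContinuousOn (fun σ => C * σ * (Rc + σ * cos θ)) _).sub ((hsliceθ θ).mono hsub)
    have hftc := intervalIntegral.integral_eq_sub_of_hasDerivAt (fun σ hσ => hm θ σ (hsub σ hσ)) hcint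
    simp only [zero_mul, zero_div, sub_zero] at hftc
    have hc1 : IntervalIntegrable (fun σ => C * σ * (Rc + σ * cos θ)) volume 0 (ρ θ) :=
      (by fun_prop : Continuous fun σ => C * σ * (Rc + σ * cos θ)).intervalIntegrable _ _
    have hc2 : IntervalIntegrable (fun σ => kθ θ σ) volume 0 (ρ θ) := ((hsliceθ θ).mono hsub).intervalIntegrable
    have hsplit := intervalIntegral.integral_sub hc1 hc2
    have hvol : ∫ σ in (0 : ℝ)..ρ θ, C * σ * (Rc + σ * cos θ) = C * volPrimKernel Rc θ (ρ θ) := by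
      rw [volPrimKernel_eq_integral, ← intervalIntegral.integral_const_mul]
      apply intervalIntegral.integral_congr; intro σ _; ring
    rw [hsplit, hvol] at hftc
    linarith
  -- P′(θ) for θ in the period
  have hP : ∀ θ ∈ uIcc 0 (2 * π), HasDerivAt P
      (C * volPrimKernel Rc θ (ρ θ) - ((L θ (1, 0)) ^ 2 + (L θ (0, 1)) ^ 2)
        * (ρ θ / ((loop Rc Zc ρ θ).1 * |radialDeriv (L θ (1, 0)) (L θ (0, 1)) θ|))) θ := by
    intro θ hθ
    obtain ⟨hDeq, hDpos⟩ := hD θ hθ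
    have hDr : radialDeriv (L θ (1, 0)) (L θ (0, 1)) θ ≠ 0 := by rw [← hDeq]; exact hDpos.ne'
    have hρ' := hasDerivAt_rayRadius_of_level hlev hcont (hψ θ hθ) hDr
    have hmov := hasDerivAt_integral_movingLimit (θ₀ := θ) hkc hkθc hkθ hρ' (Eventually.of_forall hρI')
    refine hmov.congr_deriv ?_
    rw [hdiv θ]
    -- algebra at the surface point
    have hRpos := hR θ hθ
    have hkθ' := hk θ hθ
    set Dr := radialDeriv (L θ (1, 0)) (L θ (0, 1)) θ with hDrdef
    set Dt := tangentialDeriv (L θ (1, 0)) (L θ (0, 1)) θ with hDtdef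
    have hG : (L θ (1, 0)) ^ 2 + (L θ (0, 1)) ^ 2 = Dr ^ 2 + Dt ^ 2 := gradSq_eq _ _ θ
    have hloop : (loop Rc Zc ρ θ).1 = Rc + ρ θ * cos θ := rfl
    rw [hG, hloop, ← hDeq, abs_of_pos hDpos]
    have hkval : k θ (ρ θ) = Dt / (Rc + ρ θ * cos θ) := by
      rw [eq_div_iff hRpos.ne']; exact hkθ'
    rw [hkval, hDeq]
    rw [hDeq] at hDpos
    field_simp
    ring
  -- integrate P′ over the period: P(2π) = P(0)
  have hPper : P (2 * π) = P 0 := by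
    simp only [hPdef]
    have hρ2π : ρ (2 * π) = ρ 0 := by rw [← hper 0, zero_add]
    rw [hρ2π]
    exact intervalIntegral.integral_congr fun σ _ => hkper σ
  have hvolint : IntervalIntegrable (fun θ => C * volPrimKernel Rc θ (ρ θ)) volume 0 (2 * π) := by
    apply Continuous.intervalIntegrable
    unfold volPrimKernel
    fun_prop
  have hftc := intervalIntegral.integral_eq_sub_of_hasDerivAt hP (hvolint.sub hIint)
  rw [hPper, sub_self, intervalIntegral.integral_sub hvolint hIint, intervalIntegral.integral_const_mul] at hftc
  linarith

/-- **`μ₀ I(u) = C·V(u)/2π`**: the toroidal current within the implicit surface `ψ = u` (Freidberg (6.27) `μ₀I = ∮B_p dℓ` on the glued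
loop = Jardin (5.34)) equals `C/(2πμ₀)` times the enclosed volume `torVolume` (Volume file), for a Solov'ev-class source
`Δ*ψ = C·R²` — hypotheses of `ampere_polar`. [cite: Freidberg2014, §6.3.3 eq. (6.27)] -/
theorem toroidalCurrentE_eq_torVolume (μ0 : ℝ)
    (hlev : ∀ θ ∈ Icc 0 (2 * π), rayProfile ψ Rc Zc θ (rayRadius ψ Rc Zc u θ) = u)
    (hcont : ContinuousOn (rayRadius ψ Rc Zc u) (Icc 0 (2 * π)))
    (hρI : ∀ θ ∈ Icc 0 (2 * π), rayRadius ψ Rc Zc u θ ∈ Ioo 0 smax)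
    (hψ : ∀ θ ∈ uIcc 0 (2 * π), HasFDerivAt (fun p : ℝ × ℝ => ψ p.1 p.2) (L θ) (loop Rc Zc (rayRadius ψ Rc Zc u) θ))
    (hD : ∀ θ ∈ uIcc 0 (2 * π), D θ (rayRadius ψ Rc Zc u θ) = radialDeriv (L θ (1, 0)) (L θ (0, 1)) θ
      ∧ 0 < D θ (rayRadius ψ Rc Zc u θ))
    (hk : ∀ θ ∈ uIcc 0 (2 * π), k θ (rayRadius ψ Rc Zc u θ) * (Rc + rayRadius ψ Rc Zc u θ * cos θ)
      = tangentialDeriv (L θ (1, 0)) (L θ (0, 1)) θ)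
    (hR : ∀ θ ∈ uIcc 0 (2 * π), 0 < Rc + rayRadius ψ Rc Zc u θ * cos θ)
    (hkc : ContinuousOn (fun p : ℝ × ℝ => k p.1 p.2) (univ ×ˢ Icc 0 smax))
    (hkθc : ContinuousOn (fun p : ℝ × ℝ => kθ p.1 p.2) (univ ×ˢ Icc 0 smax))
    (hkθ : ∀ θ : ℝ, ∀ σ ∈ Icc 0 smax, HasDerivAt (fun θ' => k θ' σ) (kθ θ σ) θ)
    (hkper : ∀ σ : ℝ, k (2 * π) σ = k 0 σ)
    (hm : ∀ θ : ℝ, ∀ σ ∈ Icc 0 smax,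
      HasDerivAt (fun s => s * D θ s / (Rc + s * cos θ)) (C * σ * (Rc + σ * cos θ) - kθ θ σ) σ)
    (hIint : IntervalIntegrable (fun θ => ((L θ (1, 0)) ^ 2 + (L θ (0, 1)) ^ 2)
      * (rayRadius ψ Rc Zc u θ / ((loop Rc Zc (rayRadius ψ Rc Zc u) θ).1 * |radialDeriv (L θ (1, 0)) (L θ (0, 1)) θ|)))
      volume 0 (2 * π)) :
    toroidalCurrentE μ0 ψ (loop Rc Zc (rayRadius ψ Rc Zc u)) (2 * π) = 1 / μ0 * (C / (2 * π) * torVolume ψ Rc Zc u) := by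
  have hI : uIcc 0 (2 * π) = Icc 0 (2 * π) := uIcc_of_le two_pi_pos.le
  have hρ0 : ∀ θ ∈ uIcc 0 (2 * π), 0 < rayRadius ψ Rc Zc u θ := fun θ hθ => by rw [hI] at hθ; exact (hρI θ hθ).1
  have hDr : ∀ θ ∈ uIcc 0 (2 * π), radialDeriv (L θ (1, 0)) (L θ (0, 1)) θ ≠ 0 := fun θ hθ => by
    rw [← (hD θ hθ).1]; exact (hD θ hθ).2.ne'
  have hR' : ∀ θ ∈ uIcc 0 (2 * π), 0 < (loop Rc Zc (rayRadius ψ Rc Zc u) θ).1 := hR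
  rw [toroidalCurrentE_eq_polar_rayRadius μ0 hlev hcont hρ0 hψ hDr hR',
    ampere_polar hlev hcont hρI hψ hD hk hR hkc hkθc hkθ hkper hm hIint]
  unfold torVolume
  have hπ : (π : ℝ) ≠ 0 := Real.pi_ne_zero
  field_simp

end ampere

end PolarRay

end Summit.Ventures.FusionMHD.Models

end
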